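import Mathlib
import HarnessLib
import Summits.Ventures.LatticeQCDFlow.Scoring.GaussianCochranReduction

/-!
# THE POOLED MEAN AND THE HOMOGENEITY STATISTIC OF A STANDARD GAUSSIAN VECTOR ARE INDEPENDENT:
# `N^{⊗ι}({⟨u, z⟩ ∈ A} ∩ {‖z‖² − ⟨u, z⟩² ∈ B}) = N(0,1)(A) · N^{⊗ι}{Σ_{r ≠ r₀} z_r² ∈ B}`

HONEST FRAMING: exact (Metropolis-corrected) sampling algorithms for lattice gauge theory;
figures of merit are autocorrelation/cost numbers at stated couplings and volumes; no
continuum-physics claim.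

Venture `LatticeQCDFlow` (cell pub-lqcd), topic `Scoring`; FANOUT row 4 (`s0-u1-b`, GEN-35).
NEW WORK of the cell (classical), no definition, nothing cited as a fact (the independence of the
sample mean and the residual sum of squares of a Gaussian vector — Fisher / Cochran — is NAMED ONLY).

WHY (row 4).  When `k` implementations of one sampler pass the one-shot homogeneity test of
`Scoring/KArmHomogeneityCoverage`, the natural next step is to POOL them: the inverse-variance
weighted mean `m̂ = (Σ_i x_i/σ_i²)/(Σ_i σ_i⁻²)` with squared error bar `(Σ_i σ_i⁻²)⁻¹`.  Whether the
pooled interval is still calibrated AFTER selecting on the test passing is decided, in the Gaussian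
limit, by the joint law of the linear statistic `⟨u, z⟩` (`u_i ∝ σ_i⁻¹`, the studentised pooled
mean) and the Cochran functional `‖z‖² − ⟨u, z⟩²` (the homogeneity statistic) of a standard Gaussian
vector `z`.  This Mathlib-level file proves that they are INDEPENDENT, with the marginals already in
the tree: the reflection of `Scoring/GaussianCochranReduction` taking `u` to `e_{r₀}` preserves
`N(0,1)^{⊗ι}` and carries the pair to `(z_{r₀}, Σ_{r ≠ r₀} z_r²)`, a function of DISJOINT sets of
independent coordinates.  The chain-level consequences (the pooled interval is calibrated, also
conditionally on passing the test) are not in this file.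

## Content

* **`pi_gaussianReal_eval_inter_sumSqErase_eq_mul`** (§1) — for Borel `A, B`:
  `N^{⊗ι}({z | z_{r₀} ∈ A} ∩ {z | Σ_{r ≠ r₀} z_r² ∈ B}) = N(0,1)(A) · N^{⊗ι}{z | Σ_{r ≠ r₀} z_r² ∈ B}`
  (coordinates of a product measure are independent, `iIndepFun_pi`).
* **`pi_gaussianReal_linear_inter_cochran_eq_mul`** (§2) — `Σ_i u_i² = 1`:
  `N^{⊗ι}({z | Σ_i u_i z_i ∈ A} ∩ {z | Σ_i z_i² − (Σ_i u_i z_i)² ∈ B})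
     = N(0,1)(A) · N^{⊗ι}{z | Σ_{r ≠ r₀} z_r² ∈ B}`;
  `pi_gaussianReal_linear_preimage_eq` — the marginal `N^{⊗ι}{Σ_i u_i z_i ∈ A} = N(0,1)(A)`.
* **`pi_gaussianReal_pooled_inter_homogeneity_eq_mul`** (§3) — in the `k`-arm vocabulary, with
  `x_i = μ + σ_i z_i` (`σ_i > 0`), `W = Σ_i σ_i⁻²`, `m̂ = (Σ_i x_i/σ_i²)/W`:
  `N^{⊗ι}({z | (m̂(z) − μ)·√W ∈ A} ∩ {z | Σ_i (x_i − m̂)²/σ_i² ∈ B})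
     = N(0,1)(A) · N^{⊗ι}{z | Σ_{r ≠ r₀} z_r² ∈ B}` — the studentised pooled mean is `N(0,1)`, the
  homogeneity statistic is the `k − 1`-squares functional, and the two are independent.

Mathlib + `Scoring/GaussianCochranReduction` only.  [ours] throughout.
-/

open MeasureTheory ProbabilityTheory Filter Topology Finset

namespace Summit.Ventures.LatticeQCDFlow.Scoring

open Set WithLp
open scoped RealInnerProductSpace

/-! ## §1 A coordinate and the sum of squares of the other coordinates are independent -/

section Coordinates

variable {ι : Type*} [Fintype ι] [DecidableEq ι]

/-- Under `N(0,1)^{⊗ι}` the coordinate `z_{r₀}` and `Σ_{r ≠ r₀} z_r²` are independent random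
variables. [ours] -/
theorem indepFun_eval_sumSqErase_pi_gaussianReal (r₀ : ι) :
    IndepFun (fun z : ι → ℝ => z r₀) (fun z : ι → ℝ => ∑ r ∈ univ.erase r₀, z r ^ 2)
      (Measure.pi fun _ : ι => gaussianReal 0 1) := by
  have hind : iIndepFun (fun i (z : ι → ℝ) => z i) (Measure.pi fun _ : ι => gaussianReal 0 1) :=
    iIndepFun_pi (X := fun (_ : ι) (x : ℝ) => x) fun _ => measurable_id.aemeasurable
  have hdisj : Disjoint ({r₀} : Finset ι) (univ.erase r₀) := by
    rw [Finset.disjoint_singleton_left]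
    exact Finset.notMem_erase r₀ univ
  have h2 := hind.indepFun_finset ({r₀} : Finset ι) (univ.erase r₀) hdisj
    fun i => measurable_pi_apply i
  have h3 := h2.comp
    (φ := fun x : ↥({r₀} : Finset ι) → ℝ => x ⟨r₀, Finset.mem_singleton_self r₀⟩)
    (ψ := fun y : ↥(univ.erase r₀) → ℝ => ∑ i, y i ^ 2)
    (measurable_pi_apply (X := fun _ : ↥({r₀} : Finset ι) => ℝ)
      (⟨r₀, Finset.mem_singleton_self r₀⟩ : ↥({r₀} : Finset ι)))
    (by fun_prop)
  have hψ : ((fun y : ↥(univ.erase r₀) → ℝ => ∑ i, y i ^ 2) ∘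
      fun (z : ι → ℝ) (i : ↥(univ.erase r₀)) => z i)
      = fun z : ι → ℝ => ∑ r ∈ univ.erase r₀, z r ^ 2 := by
    funext z
    simp only [Function.comp_apply]
    exact Finset.sum_coe_sort (univ.erase r₀) (fun r => z r ^ 2)
  rw [hψ] at h3
  exact h3

/-- **A COORDINATE AND THE SUM OF SQUARES OF THE OTHERS FACTORISE**: for Borel `A, B`,
`N^{⊗ι}({z | z_{r₀} ∈ A} ∩ {z | Σ_{r ≠ r₀} z_r² ∈ B}) = N(0,1)(A) · N^{⊗ι}{z | Σ_{r ≠ r₀} z_r² ∈ B}`.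
[ours] -/
theorem pi_gaussianReal_eval_inter_sumSqErase_eq_mul (r₀ : ι) {A B : Set ℝ}
    (hA : MeasurableSet A) (hB : MeasurableSet B) :
    (Measure.pi fun _ : ι => gaussianReal 0 1)
        ({z : ι → ℝ | z r₀ ∈ A} ∩ {z : ι → ℝ | ∑ r ∈ univ.erase r₀, z r ^ 2 ∈ B})
      = gaussianReal 0 1 A
        * (Measure.pi fun _ : ι => gaussianReal 0 1) {z : ι → ℝ | ∑ r ∈ univ.erase r₀, z r ^ 2 ∈ B} := by
  have h := (indepFun_eval_sumSqErase_pi_gaussianReal (ι := ι) r₀).measure_inter_preimage_eq_mul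
    A B hA hB
  have hmarg : (Measure.pi fun _ : ι => gaussianReal 0 1) ((fun z : ι → ℝ => z r₀) ⁻¹' A)
      = gaussianReal 0 1 A := by
    rw [← Measure.map_apply (measurable_pi_apply r₀) hA,
      (measurePreserving_eval (fun _ : ι => gaussianReal 0 1) r₀).map_eq]
  rw [hmarg] at h
  exact h

end Coordinates

/-! ## §2 The linear statistic `⟨u, z⟩` and the Cochran functional are independent -/

section Cochran

variable {ι : Type*} [Fintype ι] [DecidableEq ι]

/-- **THE LINEAR STATISTIC AND THE COCHRAN FUNCTIONAL FACTORISE**: for every `u : ι → ℝ` with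
`Σ_i u_i² = 1`, every `r₀` and Borel `A, B`,
`N^{⊗ι}({z | Σ_i u_i z_i ∈ A} ∩ {z | Σ_i z_i² − (Σ_i u_i z_i)² ∈ B})
  = N(0,1)(A) · N^{⊗ι}{z | Σ_{r ≠ r₀} z_r² ∈ B}` (textbook: `⟨u,z⟩ ∼ N(0,1)` independent of
`‖z‖² − ⟨u,z⟩² ∼ χ²_{k−1}`). [ours] -/
theorem pi_gaussianReal_linear_inter_cochran_eq_mul (u : ι → ℝ) (hu : ∑ i, u i ^ 2 = 1) (r₀ : ι)
    {A B : Set ℝ} (hA : MeasurableSet A) (hB : MeasurableSet B) :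
    (Measure.pi fun _ : ι => gaussianReal 0 1)
        ({z : ι → ℝ | ∑ i, u i * z i ∈ A} ∩ {z : ι → ℝ | ∑ i, z i ^ 2 - (∑ i, u i * z i) ^ 2 ∈ B})
      = gaussianReal 0 1 A
        * (Measure.pi fun _ : ι => gaussianReal 0 1) {z : ι → ℝ | ∑ r ∈ univ.erase r₀, z r ^ 2 ∈ B} := by
  set uE : EuclideanSpace ℝ ι := toLp 2 u with huE
  have hnu : ‖uE‖ = 1 := by
    have h2 : ‖uE‖ ^ 2 = 1 := by
      rw [EuclideanSpace.real_norm_sq_eq]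
      simpa [huE] using hu
    have h0 : 0 ≤ ‖uE‖ := norm_nonneg _
    nlinarith [h2, h0]
  set O := ((ℝ ∙ (uE - EuclideanSpace.single r₀ (1 : ℝ)))ᗮ).reflection with hO
  have hmp := measurePreserving_euclidean_isometry_pi (ι := ι) O
  have hTm : MeasurableSet ({w : ι → ℝ | w r₀ ∈ A} ∩ {w : ι → ℝ | ∑ r ∈ univ.erase r₀, w r ^ 2 ∈ B}) :=
    ((measurable_pi_apply r₀) hA).inter ((by fun_prop : Measurable fun w : ι → ℝ =>
      ∑ r ∈ univ.erase r₀, w r ^ 2) hB)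
  have hcoord : ∀ z : ι → ℝ, (ofLp (O (toLp 2 z)) : ι → ℝ) r₀ = ∑ i, u i * z i := fun z => by
    have h := reflection_unit_coord uE hnu r₀ (toLp 2 z)
    rw [← hO] at h
    have h' : (ofLp (O (toLp 2 z)) : ι → ℝ) r₀ = ⟪(toLp 2 z : EuclideanSpace ℝ ι), uE⟫ := by
      simpa using h
    rw [h', huE, inner_toLp_toLp_eq_sum]
  have hsq : ∀ z : ι → ℝ, ∑ r ∈ univ.erase r₀, (ofLp (O (toLp 2 z)) : ι → ℝ) r ^ 2
      = ∑ i, z i ^ 2 - (∑ i, u i * z i) ^ 2 := fun z => by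
    have h := sum_sq_erase_reflection_unit uE hnu r₀ (toLp 2 z)
    rw [← hO] at h
    have h' : ∑ r ∈ univ.erase r₀, (ofLp (O (toLp 2 z))) r ^ 2 = ‖(toLp 2 z : EuclideanSpace ℝ ι)‖ ^ 2
        - ⟪(toLp 2 z : EuclideanSpace ℝ ι), uE⟫ ^ 2 := by
      simpa using h
    rw [h', EuclideanSpace.real_norm_sq_eq, huE, inner_toLp_toLp_eq_sum]
  have hpre : ({z : ι → ℝ | ∑ i, u i * z i ∈ A} ∩ {z : ι → ℝ | ∑ i, z i ^ 2 - (∑ i, u i * z i) ^ 2 ∈ B})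
      = (fun z : ι → ℝ => ofLp (O (toLp 2 z))) ⁻¹'
        ({w : ι → ℝ | w r₀ ∈ A} ∩ {w : ι → ℝ | ∑ r ∈ univ.erase r₀, w r ^ 2 ∈ B}) := by
    ext z
    simp only [Set.mem_inter_iff, Set.mem_setOf_eq, Set.mem_preimage, hcoord z, hsq z]
  rw [hpre, ← Measure.map_apply hmp.measurable hTm, hmp.map_eq]
  exact pi_gaussianReal_eval_inter_sumSqErase_eq_mul r₀ hA hB

/-- **The marginal of the linear statistic**: `Σ_i u_i² = 1` ⇒ `N^{⊗ι}{z | Σ_i u_i z_i ∈ A} = N(0,1)(A)`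
(`ι` nonempty). [ours] -/
theorem pi_gaussianReal_linear_preimage_eq [Nonempty ι] (u : ι → ℝ) (hu : ∑ i, u i ^ 2 = 1)
    {A : Set ℝ} (hA : MeasurableSet A) :
    (Measure.pi fun _ : ι => gaussianReal 0 1) {z : ι → ℝ | ∑ i, u i * z i ∈ A}
      = gaussianReal 0 1 A := by
  obtain ⟨r₀⟩ := ‹Nonempty ι›
  have h := pi_gaussianReal_linear_inter_cochran_eq_mul u hu r₀ hA MeasurableSet.univ
  have h1 : {z : ι → ℝ | ∑ i, z i ^ 2 - (∑ i, u i * z i) ^ 2 ∈ (Set.univ : Set ℝ)} = Set.univ := by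
    ext z; simp
  have h2 : {z : ι → ℝ | ∑ r ∈ univ.erase r₀, z r ^ 2 ∈ (Set.univ : Set ℝ)} = Set.univ := by
    ext z; simp
  rw [h1, h2, Set.inter_univ, measure_univ, mul_one] at h
  exact h

end Cochran

/-! ## §3 In the `k`-arm vocabulary: the studentised pooled mean and the homogeneity statistic -/

section Pooled

variable {ι : Type*} [Fintype ι] [DecidableEq ι]

omit [DecidableEq ι] in
/-- **The studentised pooled mean in standardised coordinates**: with `x_i = μ + σ_i z_i`
(`σ_i ≠ 0`), `W = Σ_i σ_i⁻² ≠ 0`, `m̂ = (Σ_i x_i/σ_i²)/W`:  `m̂ − μ = (Σ_i z_i/σ_i)/W`. [ours] -/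
theorem pooledMean_sub_eq (μ : ℝ) (σ z : ι → ℝ) (hσ : ∀ i, σ i ≠ 0)
    (hW : ∑ i, (σ i ^ 2)⁻¹ ≠ 0) :
    (∑ j, (μ + σ j * z j) / σ j ^ 2) / (∑ j, (σ j ^ 2)⁻¹) - μ
      = (∑ i, z i / σ i) / ∑ i, (σ i ^ 2)⁻¹ := by
  set W := ∑ i, (σ i ^ 2)⁻¹ with hWdef
  have hsum1 : ∑ j, (μ + σ j * z j) / σ j ^ 2 = μ * W + ∑ i, z i / σ i := by
    rw [hWdef, Finset.mul_sum, ← Finset.sum_add_distrib]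
    refine Finset.sum_congr rfl fun j _ => ?_
    field_simp [hσ j]
  rw [hsum1]
  field_simp
  ring

/-- **THE STUDENTISED POOLED MEAN AND THE HOMOGENEITY STATISTIC OF INDEPENDENT STANDARD NORMAL
COORDINATES FACTORISE**: for `σ_i > 0`, every `μ`, `r₀` and Borel `A, B`, with `x_i = μ + σ_i z_i`,
`W = Σ_i σ_i⁻²`, `m̂ = (Σ_i x_i/σ_i²)/W`,
`N^{⊗ι}({z | (m̂(z) − μ)·√W ∈ A} ∩ {z | Σ_i (x_i − m̂(z))²/σ_i² ∈ B})
  = N(0,1)(A) · N^{⊗ι}{z | Σ_{r ≠ r₀} z_r² ∈ B}` — in the large-sample Gaussian picture of `k`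
arm estimates with standard errors `σ_i` and a COMMON centre `μ`, the studentised inverse-variance
pooled mean is standard normal, the homogeneity statistic is the `k − 1`-squares functional, and
they are independent (textbook: `N(0,1) ⊗ χ²_{k−1}`). [ours] -/
theorem pi_gaussianReal_pooled_inter_homogeneity_eq_mul (μ : ℝ) (σ : ι → ℝ) (hσ : ∀ i, 0 < σ i)
    (r₀ : ι) {A B : Set ℝ} (hA : MeasurableSet A) (hB : MeasurableSet B) :
    (Measure.pi fun _ : ι => gaussianReal 0 1)
        ({z : ι → ℝ | ((∑ j, (μ + σ j * z j) / σ j ^ 2) / (∑ j, (σ j ^ 2)⁻¹) - μ)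
            * Real.sqrt (∑ j, (σ j ^ 2)⁻¹) ∈ A}
          ∩ {z : ι → ℝ | ∑ i, ((μ + σ i * z i) - (∑ j, (μ + σ j * z j) / σ j ^ 2) / (∑ j, (σ j ^ 2)⁻¹)) ^ 2
            / σ i ^ 2 ∈ B})
      = gaussianReal 0 1 A
        * (Measure.pi fun _ : ι => gaussianReal 0 1) {z : ι → ℝ | ∑ r ∈ univ.erase r₀, z r ^ 2 ∈ B} := by
  have hne : Nonempty ι := ⟨r₀⟩
  set W := ∑ i, (σ i ^ 2)⁻¹ with hWdef
  have hW : 0 < W := Finset.sum_pos (fun i _ => by have := hσ i; positivity) Finset.univ_nonempty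
  set u : ι → ℝ := fun i => (σ i)⁻¹ / Real.sqrt W with hu
  have hu1 : ∑ i, u i ^ 2 = 1 := by
    simp only [hu, div_pow, inv_pow, Real.sq_sqrt hW.le]
    rw [← Finset.sum_div, ← hWdef, div_self hW.ne']
  have hlin : ∀ z : ι → ℝ, ∑ i, u i * z i = (∑ i, z i / σ i) / Real.sqrt W := fun z => by
    rw [Finset.sum_div]
    refine Finset.sum_congr rfl fun i _ => ?_
    simp only [hu]
    field_simp
  have hsqrtW : Real.sqrt W ≠ 0 := (Real.sqrt_pos.2 hW).ne'
  have hset1 : {z : ι → ℝ | ((∑ j, (μ + σ j * z j) / σ j ^ 2) / (∑ j, (σ j ^ 2)⁻¹) - μ)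
        * Real.sqrt (∑ j, (σ j ^ 2)⁻¹) ∈ A} = {z : ι → ℝ | ∑ i, u i * z i ∈ A} := by
    ext z
    simp only [Set.mem_setOf_eq]
    rw [pooledMean_sub_eq μ σ z (fun i => (hσ i).ne') hW.ne', hlin z, ← hWdef]
    have : (∑ i, z i / σ i) / W * Real.sqrt W = (∑ i, z i / σ i) / Real.sqrt W := by
      rw [div_mul_eq_mul_div, div_eq_div_iff hW.ne' hsqrtW]
      calc (∑ i, z i / σ i) * Real.sqrt W * Real.sqrt W
          = (∑ i, z i / σ i) * (Real.sqrt W * Real.sqrt W) := by ring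
        _ = (∑ i, z i / σ i) * W := by rw [Real.mul_self_sqrt hW.le]
    rw [this]
  have hset2 : {z : ι → ℝ | ∑ i, ((μ + σ i * z i) - (∑ j, (μ + σ j * z j) / σ j ^ 2) / (∑ j, (σ j ^ 2)⁻¹)) ^ 2
        / σ i ^ 2 ∈ B} = {z : ι → ℝ | ∑ i, z i ^ 2 - (∑ i, u i * z i) ^ 2 ∈ B} := by
    ext z
    simp only [Set.mem_setOf_eq]
    rw [homogeneity_statistic_eq μ σ z (fun i => (hσ i).ne') hW.ne']
    have hS : (∑ i, u i * z i) ^ 2 = (∑ i, z i / σ i) ^ 2 / W := by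
      rw [hlin z, div_pow, Real.sq_sqrt hW.le]
    rw [hS]
  rw [hset1, hset2]
  exact pi_gaussianReal_linear_inter_cochran_eq_mul u hu1 r₀ hA hB

/-- **The marginal of the studentised pooled mean is standard normal**: same setting,
`N^{⊗ι}{z | (m̂(z) − μ)·√W ∈ A} = N(0,1)(A)`. [ours] -/
theorem pi_gaussianReal_pooled_preimage_eq [Nonempty ι] (μ : ℝ) (σ : ι → ℝ) (hσ : ∀ i, 0 < σ i)
    {A : Set ℝ} (hA : MeasurableSet A) :
    (Measure.pi fun _ : ι => gaussianReal 0 1)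
        {z : ι → ℝ | ((∑ j, (μ + σ j * z j) / σ j ^ 2) / (∑ j, (σ j ^ 2)⁻¹) - μ)
            * Real.sqrt (∑ j, (σ j ^ 2)⁻¹) ∈ A}
      = gaussianReal 0 1 A := by
  obtain ⟨r₀⟩ := ‹Nonempty ι›
  classical
  have h := pi_gaussianReal_pooled_inter_homogeneity_eq_mul μ σ hσ r₀ hA MeasurableSet.univ
  have h1 : {z : ι → ℝ | ∑ i, ((μ + σ i * z i) - (∑ j, (μ + σ j * z j) / σ j ^ 2) / (∑ j, (σ j ^ 2)⁻¹)) ^ 2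
        / σ i ^ 2 ∈ (Set.univ : Set ℝ)} = Set.univ := by
    ext z; simp
  have h2 : {z : ι → ℝ | ∑ r ∈ univ.erase r₀, z r ^ 2 ∈ (Set.univ : Set ℝ)} = Set.univ := by
    ext z; simp
  rw [h1, h2, Set.inter_univ, measure_univ, mul_one] at h
  exact h

end Pooled

end Summit.Ventures.LatticeQCDFlow.Scoring
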